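import Summits.HodgeConjecture.HodgeConjecture.Theorems.F0P2eStubLTLocalTypeTransport   -- ★ `stubLT_of_LR` (LT at every enumeration from LR; `M_x` at `Equiv.prodUnique`, S6a)
import Summits.HodgeConjecture.HodgeConjecture.Theorems.F0P2eStubLRLocalReindex         -- ★ `stubLR_holds` (LR: `X_v[e] ≃ X_v[e']`, global road over Liu's carrier — needs `χ ∈ Chi`)
import Summits.HodgeConjecture.HodgeConjecture.Theorems.F0P2iVocabularyBridge           -- ★ `xTheta_eq_CM` (the LT spelling IS ★ `xThetaCM`, `rfl`)
import Summits.HodgeConjecture.HodgeConjecture.Theorems.F0P2iThetaTypeCriterion         -- ★ `isotypicComponent_eq_top_of_equiv` (isotypy moves along an equivalence of the TYPE)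
import Summits.HodgeConjecture.HodgeConjecture.Theorems.F0P2iGRDSplitTransport          -- ★ `nonempty_equiv_comp` (an equivalence restricts along any `φ : H →* G`)
import Literature.NumberTheory.GelbartRogawski1991.CMThetaTypeVocabulary                -- ★ `ThetaTypeAtCM`, `xThetaCM`, `chiLocalSplittingsCM`
import HarnessLib

/-!
# K2 ∕ E2 «WeilCharacterThetaRoad», (D)-road brick D4 — WITT-CLASS INVARIANCE OF THE THETA TYPE, for an AUTOMORPHIC `χ_f`: if `ε₂ε₁⁻¹ ∈ N(L_vˣ)` then a
# class which is the theta type `X_v(μ, ε₁, χ_f) ∘ κ_v⁻¹` is the theta type `X_v(μ, ε₂, χ_f) ∘ κ_v⁻¹` — at EVERY enumeration `e₁`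

Cell hodgecm-mathlib, Track B «K2-LIT», crux item h413 = stmt-HodgeConjecture-24833; ENGINE E2, tier 0 `Cruxes/H413/Lines/K2_E2_WeilCharacterThetaRoad.lean`
(K2E2-plan (g3)), socket (D4) `stub_thetaTypeWittClassInvariant : StubThetaTypeWittClassInvariant` (:394; bricks (D1)(D2)(D4) ⟹ (D) by ★
`piNOtherTowerThetaType_of_bricks`).  Desk file of K2-defs1 (g4) (K2-lead (g1) deal 06:02:59Z).  THEOREMS ONLY (no `def`, no instance, no notation, no
named fact, no `sorry`); lane `--supports stmt-HodgeConjecture-24833 --as helper`.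

THE CENSUS (K2 bus 06:27Z) AND THE SHAPE OF THIS FILE.  Print: the Weil representation `ω(γ, ψ^{ε}, χ)` of the pair `(U(V), U(⟨ε⟩))` depends on the line
`ε` only through its class modulo `N(E_vˣ)` [GelbartRogawski1991 §3.1 Prop. 3.1.1, Lem. 5.1.2 «`ψ_v` … modulo `N_{E∕F}(E_v^*)`»; Liu2021 Lem. D.1 (3);
MVW87 Chap. 3 IV.4].  In the tree this is ★ in two layers: (LTpu) at the enumeration `Equiv.prodUnique (Fin 3) (Fin 1)` the line isometry `M_x` of
★ `lineTransportOp` descends to `X_v(μ,a₁,χ) ≃ X_v(μ,a₂,χ)` (★ `F0P2eStubLTLocalTypeTransport.stubLT_prodUnique_holds`, over ★ S6a and ★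
`lineTransportOp_omegaLoc_localLineInl'`), and (LR) the local theta type does not depend on the enumeration (★ `F0P2eStubLRLocalReindex.stubLR_holds`,
proved by the GLOBAL road through Liu's carrier `ω(μ,a,χ)` — hence ONLY for AUTOMORPHIC `χ ∈ Chi`); ★ `stubLT_of_LR` composes them at EVERY `e₁`.
The socket D4 as typed quantifies a bare continuous unitary `χ_f`; the (D)-road itself carries `IsAutomorphicOneChar χ_f` (binder `haut` of
`StubPiNOtherTowerThetaType` :243).  THIS FILE pays the R8-twin **D4ᴬ = D4 with the single extra binder `IsAutomorphicOneChar … χf →`** (inserted after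
the unitarity binder; every other token of `StubThetaTypeWittClassInvariant` unchanged, general `e₁` kept) — `thetaTypeWittClassInvariant_of_isAutomorphicOneChar` —,
which the composition can feed with its own `haut`.

* §1 `lineDelta_witness_of_mul_conjLocal_eq` — the socket's norm witness `x·x̄ = ε₂ε₁⁻¹` in `L ⊗ L⁺_v` is turned into the line-transport witness
  `ε₂⁻¹δ = y·ȳ·ε₁⁻¹δ` of (LTpu)∕S6a with `y := x⁻¹` (units of the commutative ring `LocalRing L v`; `δ = imagUnit L`).
* §2 `nonempty_equiv_xThetaCM_of_mul_conjLocal_eq` — `X_v(μ, ε₁, χ_f) ≃ X_v(μ, ε₂, χ_f)` (★ `xThetaCM`, any `e₁`) for automorphic `χ_f` and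
  `ε₂ε₁⁻¹ ∈ N`: ★ `stubLT_of_LR` ★ `stubLR_holds` at `⟨χf, haut⟩ : Chi`, read on ★ `xThetaCM` by ★ `xTheta_eq_CM` (`rfl`).
* §3 HEAD `thetaTypeWittClassInvariant_of_isAutomorphicOneChar` — unfold ★ `ThetaTypeAtCM`: the `X_v(ε₁) ∘ κ_v⁻¹`-isotypy of every `τ`-isotypic `ρ′`
  becomes `X_v(ε₂) ∘ κ_v⁻¹`-isotypy along the equivalence of the TYPES restricted along `κ_v⁻¹` (§2, ★ `F0P2iGRDSplitTransport.nonempty_equiv_comp`,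
  ★ `isotypicComponent_eq_top_of_equiv`).
* §4 WITHOUT automorphy, at `e₁ := Equiv.prodUnique (Fin 3) (Fin 1)`: `nonempty_equiv_xThetaCM_prodUnique_of_lineDelta_witness` (the proof of ★
  `stubLT_prodUnique_holds` with `χ.1 ↦ χf`, read on ★ `xThetaCM`) and **`thetaTypeWittClassInvariant_prodUnique`** = socket D4's body with the enumeration
  binder instantiated at `Equiv.prodUnique (Fin 3) (Fin 1)`, token for token otherwise.
References: [GelbartRogawski1991] S. Gelbart, J. Rogawski, Invent. Math. 105 (1991), §3.1 Prop. 3.1.1 p. 455, Remark p. 457, Lem. 5.1.2 p. 466;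
[MoeglinVignerasWaldspurger1987] LNM 1291, Chap. 2 II.1 (A)–(B), Chap. 3 I.1–I.3, IV.4; [Liu2021] Camb. J. Math. 9 (2021), Def. 4.11, App. D Lem. D.1 (3);
[Kudla1994] Israel J. Math. 87, §3 Thm. 3.1; [BourbakiAlgebreVIII2012] VIII §4 n°2.
HONEST LABEL: HC_CM is proved only modulo the 7 printed citations (2 remaining named inputs: hLiu418 = stmt-HodgeConjecture-24832,
h413 = stmt-HodgeConjecture-24833) until rung 0 closes; (O2θ-W1) is an ALTERNATIVE road to (O2♮), not a letter payment; this count-neutral helper pays the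
automorphic twin of D4 — D4 verbatim (non-automorphic `χ_f`, general `e₁`) still needs a LOCAL re-enumeration brick the tree does not have.
-/

set_option autoImplicit false
-- the mandated namespace repeats the single-problem summit's segment (`HodgeConjecture.HodgeConjecture`)
set_option linter.dupNamespace false

noncomputable section

open NumberField IsDedekindDomain MeasureTheory
open scoped Matrix ComplexOrder

namespace Summit.HodgeConjecture.HodgeConjecture.Cruxes.H413.K2E2WThetaTypeWittClassInvariant

open Literature.NumberTheory Literature.NumberTheory.Automorphic Literature.NumberTheory.Automorphic.UnitaryGroup
open Literature.NumberTheory.Automorphic.IdeleClassGroup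
open Literature.NumberTheory.Automorphic.Liu2021 Literature.NumberTheory.Automorphic.Liu2021.Def411WeilCarriers
open Literature.NumberTheory.Automorphic.Liu2021.Def411WeilCarriersDoubling
open Literature.NumberTheory.GelbartRogawski1991 Literature.NumberTheory.GelbartRogawski1991.UnitaryDualPair
open Literature.NumberTheory.GelbartRogawski1991.UnitaryDualPair.WeilCoinv
open Literature.NumberTheory.GelbartRogawski1991.UnitaryDualPair.LocalSplitting
open Literature.NumberTheory.GaloisRepresentations Literature.NumberTheory.Rogawski1990
open Literature.RepresentationTheory Literature.RepresentationTheory.Liu2021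
open Summit.HodgeConjecture.CorCM.Transposition

/-! ## §1 The norm witness of the socket as a line-transport witness -/

/-- **`x·x̄ = ε₂ε₁⁻¹ ⟹ ε₂⁻¹δ = x⁻¹·x̄⁻¹·ε₁⁻¹δ`** in `L ⊗ L⁺_v` (`δ = imagUnit L`; `conjLocal` is a ring homomorphism, the units of a commutative ring form a
commutative group). [folklore] -/
theorem lineDelta_witness_of_mul_conjLocal_eq (L : Type) [Field L] [NumberField L] [IsCMField L]
    (v : HeightOneSpectrum (𝓞 ↥(maximalRealSubfield L))) (ε₁ ε₂ : (↥(maximalRealSubfield L))ˣ) (x : (LocalRing L v)ˣ)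
    (hx : (x : LocalRing L v) * conjLocal L (IsCMField.complexConj L) v x =
      algebraMap L (LocalRing L v) (((ε₂ * ε₁⁻¹ : (↥(maximalRealSubfield L))ˣ) : ↥(maximalRealSubfield L)) : L)) :
    algebraMap L (LocalRing L v) (algebraMap (↥(maximalRealSubfield L)) L (↑ε₂⁻¹ : ↥(maximalRealSubfield L)) * imagUnit L) =
      ((x⁻¹ : (LocalRing L v)ˣ) : LocalRing L v) * conjLocal L (IsCMField.complexConj L) v ((x⁻¹ : (LocalRing L v)ˣ) : LocalRing L v) *
        algebraMap L (LocalRing L v) (algebraMap (↥(maximalRealSubfield L)) L (↑ε₁⁻¹ : ↥(maximalRealSubfield L)) * imagUnit L) := by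
  set φ : ↥(maximalRealSubfield L) →+* LocalRing L v := (algebraMap L (LocalRing L v)).comp (algebraMap (↥(maximalRealSubfield L)) L) with hφ
  have hx' : (x : LocalRing L v) * conjLocal L (IsCMField.complexConj L) v x = φ ((ε₂ * ε₁⁻¹ : (↥(maximalRealSubfield L))ˣ) : ↥(maximalRealSubfield L)) := hx
  -- `x⁻¹ x̄⁻¹` and `ε₁ε₂⁻¹` are both inverse to `x x̄ = ε₂ε₁⁻¹`
  have h1 : ((x⁻¹ : (LocalRing L v)ˣ) : LocalRing L v) * conjLocal L (IsCMField.complexConj L) v ((x⁻¹ : (LocalRing L v)ˣ) : LocalRing L v) *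
      ((x : LocalRing L v) * conjLocal L (IsCMField.complexConj L) v x) = 1 := by
    rw [mul_mul_mul_comm, Units.inv_mul, ← map_mul, Units.inv_mul, map_one, one_mul]
  have h2 : φ ((ε₁ * ε₂⁻¹ : (↥(maximalRealSubfield L))ˣ) : ↥(maximalRealSubfield L)) *
      ((x : LocalRing L v) * conjLocal L (IsCMField.complexConj L) v x) = 1 := by
    rw [hx', ← map_mul, ← Units.val_mul, show (ε₁ * ε₂⁻¹ * (ε₂ * ε₁⁻¹) : (↥(maximalRealSubfield L))ˣ) = 1 by group, Units.val_one, map_one]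
  have hinv : ((x⁻¹ : (LocalRing L v)ˣ) : LocalRing L v) * conjLocal L (IsCMField.complexConj L) v ((x⁻¹ : (LocalRing L v)ˣ) : LocalRing L v) =
      φ ((ε₁ * ε₂⁻¹ : (↥(maximalRealSubfield L))ˣ) : ↥(maximalRealSubfield L)) :=
    calc ((x⁻¹ : (LocalRing L v)ˣ) : LocalRing L v) * conjLocal L (IsCMField.complexConj L) v ((x⁻¹ : (LocalRing L v)ˣ) : LocalRing L v)
        = ((x⁻¹ : (LocalRing L v)ˣ) : LocalRing L v) * conjLocal L (IsCMField.complexConj L) v ((x⁻¹ : (LocalRing L v)ˣ) : LocalRing L v) *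
            (φ ((ε₁ * ε₂⁻¹ : (↥(maximalRealSubfield L))ˣ) : ↥(maximalRealSubfield L)) *
              ((x : LocalRing L v) * conjLocal L (IsCMField.complexConj L) v x)) := by rw [h2, mul_one]
      _ = φ ((ε₁ * ε₂⁻¹ : (↥(maximalRealSubfield L))ˣ) : ↥(maximalRealSubfield L)) *
            (((x⁻¹ : (LocalRing L v)ˣ) : LocalRing L v) * conjLocal L (IsCMField.complexConj L) v ((x⁻¹ : (LocalRing L v)ˣ) : LocalRing L v) *
              ((x : LocalRing L v) * conjLocal L (IsCMField.complexConj L) v x)) := by ring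
      _ = φ ((ε₁ * ε₂⁻¹ : (↥(maximalRealSubfield L))ˣ) : ↥(maximalRealSubfield L)) := by rw [h1, mul_one]
  -- `ε₁ε₂⁻¹ · ε₁⁻¹ = ε₂⁻¹`
  have h3 : φ ((ε₁ * ε₂⁻¹ : (↥(maximalRealSubfield L))ˣ) : ↥(maximalRealSubfield L)) * φ (↑ε₁⁻¹ : ↥(maximalRealSubfield L)) =
      φ (↑ε₂⁻¹ : ↥(maximalRealSubfield L)) := by
    rw [← map_mul, ← Units.val_mul, mul_assoc, mul_comm ε₂⁻¹ ε₁⁻¹, ← mul_assoc, mul_inv_cancel, one_mul]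
  rw [hinv, map_mul (algebraMap L (LocalRing L v)), map_mul (algebraMap L (LocalRing L v))]
  change φ _ * _ = φ _ * (φ _ * _)
  rw [← mul_assoc, h3]

/-! ## §2 `X_v(μ, ε₁, χ_f) ≃ X_v(μ, ε₂, χ_f)` at every enumeration, for automorphic `χ_f` -/

set_option synthInstance.maxHeartbeats 400000 in
set_option maxHeartbeats 8000000 in
-- heartbeats: reading ★ `stubLT_of_LR`'s conclusion (spelled over ★ B01 `chiLocalSplittingsD ⟨L⟩`, a `def`) on ★ `xThetaCM` (over the Literature `abbrev`
-- `chiLocalSplittingsCM`) is a definitional unfolding of the two CM packages — the budget of ★ `F0P2iVocabularyBridge.xTheta_eq_CM` (`rfl`, 8 000 000).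
/-- **Liu's local theta type depends on the line only through its norm class, at every enumeration `e₁`, for AUTOMORPHIC `χ_f`**: if `x·x̄ = ε₂ε₁⁻¹`
in `L ⊗ L⁺_v` then `X_v(μ, ε₁, χ_f) ≃ X_v(μ, ε₂, χ_f)` (★ `xThetaCM`) as representations of `U(diag dV)(L⁺_v)` — ★ LT (`stubLT_of_LR stubLR_holds`: the
line isometry `M_x` at `Equiv.prodUnique` ∘ the re-enumeration LR, which is where automorphy enters) at `⟨χf, haut⟩ : Chi`, read on ★ `xThetaCM` (★
`xTheta_eq_CM`, `rfl`). [cite: GelbartRogawski1991, §3.1 Prop. 3.1.1 p. 455; Lem. 5.1.2 p. 466] [cite: Liu2021, App. D Lem. D.1 (3)]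
[cite: MoeglinVignerasWaldspurger1987, Chap. 3 IV.4] -/
theorem nonempty_equiv_xThetaCM_of_mul_conjLocal_eq (L : Type) [Field L] [NumberField L] [IsCMField L] {n' : ℕ} (e₁ : Fin 3 × Fin 1 ≃ Fin n')
    (dV : Fin 3 → L) (hdV : ∀ i, IsCMField.complexConj L (dV i) = dV i) (hdV0 : ∀ i, dV i ≠ 0)
    (μ : Literature.NumberTheory.Automorphic.IdeleClassGroup L →ₜ* Circle) (hμ : IsConjugateSymplectic L μ)
    (χf : UnitaryGroup.finAdelicOne (↥(maximalRealSubfield L)) L (IsCMField.complexConj L) →* ℂˣ)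
    (haut : IsAutomorphicOneChar (↥(maximalRealSubfield L)) L (IsCMField.complexConj L) χf)
    (v : HeightOneSpectrum (𝓞 ↥(maximalRealSubfield L))) (ε₁ ε₂ : (↥(maximalRealSubfield L))ˣ) (x : (LocalRing L v)ˣ)
    (hx : (x : LocalRing L v) * conjLocal L (IsCMField.complexConj L) v x =
      algebraMap L (LocalRing L v) (((ε₂ * ε₁⁻¹ : (↥(maximalRealSubfield L))ˣ) : ↥(maximalRealSubfield L)) : L)) :
    Nonempty (Representation.Equiv (xThetaCM L e₁ dV hdV hdV0 μ hμ χf ε₁ v) (xThetaCM L e₁ dV hdV hdV0 μ hμ χf ε₂ v)) := by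
  obtain ⟨E⟩ := F0P2eStubLTLocalTypeTransport.stubLT_of_LR F0P2eStubLRLocalReindex.stubLR_holds L e₁ dV hdV hdV0 μ hμ ε₁ ε₂
    ⟨χf, haut⟩ v x⁻¹ (lineDelta_witness_of_mul_conjLocal_eq L v ε₁ ε₂ x hx)
  rw [F0P2iVocabularyBridge.xTheta_eq_CM L e₁ dV hdV hdV0 μ hμ _ ε₁ v, F0P2iVocabularyBridge.xTheta_eq_CM L e₁ dV hdV hdV0 μ hμ _ ε₂ v] at E
  exact ⟨E⟩

/-! ## §3 The head: the automorphic twin D4ᴬ of socket (D4) -/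

set_option synthInstance.maxHeartbeats 400000 in
set_option maxHeartbeats 8000000 in
-- heartbeats: the binder block of the socket (two `ThetaTypeAtCM` predicates over the CM packages) at the budget of its neighbours (★ `F0P2oThetaTypeNotL2`).
/-- **D4ᴬ — WITT-CLASS INVARIANCE OF THE THETA TYPE, automorphic `χ_f`** (the R8-twin of tier-0 `StubThetaTypeWittClassInvariant` :394 with the ONE
extra binder `IsAutomorphicOneChar … χf →` after the unitarity binder; general enumeration `e₁` kept).  If `ε₂ ε₁⁻¹ = x·x̄` for a unit `x` of `L ⊗ L⁺_v`
(the hermitian lines `⟨ε₁⟩`, `⟨ε₂⟩` are isometric), a class of `U(H)(L⁺_v)` which IS the theta type `X_v(μ,ε₁,χ_f) ∘ κ_v⁻¹` (★ `ThetaTypeAtCM`) IS the theta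
type `X_v(μ,ε₂,χ_f) ∘ κ_v⁻¹`: unfold the predicate and move the isotypy of every `τ`-isotypic `ρ′` along the equivalence of the types `X_v(ε₁) ∘ κ_v⁻¹ ≃
X_v(ε₂) ∘ κ_v⁻¹` (§2, ★ `nonempty_equiv_comp`, ★ `isotypicComponent_eq_top_of_equiv`).  The (D) composition ★ `piNOtherTowerThetaType_of_bricks` has `haut` in scope.
[cite: GelbartRogawski1991, §3.1 Prop. 3.1.1 p. 455; Lem. 5.1.2 p. 466] [cite: MoeglinVignerasWaldspurger1987, Chap. 3 §IV.4] [cite: Liu2021, Def. 4.11; App. D Lem. D.1 (3)]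
[cite: BourbakiAlgebreVIII2012, VIII §4 n°2] -/
theorem thetaTypeWittClassInvariant_of_isAutomorphicOneChar :
    ∀ (L : Type) [Field L] [NumberField L] [IsCMField L] (H : Matrix (Fin 3) (Fin 3) L) {n' : ℕ} (e₁ : Fin 3 × Fin 1 ≃ Fin n')
    (dV : Fin 3 → L) (hdV : ∀ i, IsCMField.complexConj L (dV i) = dV i) (hdV0 : ∀ i, dV i ≠ 0) (g : GL (Fin 3) L)
    (hg : ((g : Matrix (Fin 3) (Fin 3) L).map (cmConjRingHom L))ᵀ * H * (g : Matrix (Fin 3) (Fin 3) L) = Matrix.diagonal dV)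
    (μ : Literature.NumberTheory.Automorphic.IdeleClassGroup L →ₜ* Circle) (hμ : IsConjugateSymplectic L μ)
    (χf : UnitaryGroup.finAdelicOne (↥(maximalRealSubfield L)) L (IsCMField.complexConj L) →* ℂˣ),
    Continuous χf → (∀ z, ‖((χf z : ℂˣ) : ℂ)‖ = 1) →
    IsAutomorphicOneChar (↥(maximalRealSubfield L)) L (IsCMField.complexConj L) χf →
    ∀ (v : HeightOneSpectrum (𝓞 ↥(maximalRealSubfield L))), (∀ w : PlacesOver L v, IsCMField.complexConj L • w.1 = w.1) →
    ∀ (ε₁ ε₂ : (↥(maximalRealSubfield L))ˣ),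
      (∃ x : (LocalRing L v)ˣ, (x : LocalRing L v) * conjLocal L (IsCMField.complexConj L) v x =
        algebraMap L (LocalRing L v) (((ε₂ * ε₁⁻¹ : (↥(maximalRealSubfield L))ˣ) : ↥(maximalRealSubfield L)) : L)) →
      ∀ (c : IrrClass ((cmDatum L 3 H).Local v)),
        ThetaTypeAtCM L H e₁ dV hdV hdV0 g hg μ hμ χf ε₁ v c → ThetaTypeAtCM L H e₁ dV hdV hdV0 g hg μ hμ χf ε₂ v c := by
  intro L _ _ _ H n' e₁ dV hdV hdV0 g hg μ hμ χf _ _ haut v _ ε₁ ε₂ hN c hθ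
  obtain ⟨x, hx⟩ := hN
  obtain ⟨E⟩ := nonempty_equiv_xThetaCM_of_mul_conjLocal_eq L e₁ dV hdV hdV0 μ hμ χf haut v ε₁ ε₂ x hx
  obtain ⟨E'⟩ := F0P2iGRDSplitTransport.nonempty_equiv_comp E
    (localCongr L (IsCMField.complexConj L) g one_ne_zero (by rw [one_smul]; exact hg) v).symm.toMulEquiv.toMonoidHom
  intro T _ _ τ hτ hconst W' _ _ ρ' hρ'
  exact F0P2iThetaTypeCriterion.isotypicComponent_eq_top_of_equiv ρ' E' (hθ T τ hτ hconst W' ρ' hρ')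

/-! ## §4 At the enumeration `Equiv.prodUnique (Fin 3) (Fin 1)`, WITHOUT automorphy: socket D4 verbatim at `e₁ := Equiv.prodUnique` -/

set_option synthInstance.maxHeartbeats 400000 in
set_option maxHeartbeats 8000000 in
-- heartbeats: as ★ `F0P2eStubLTLocalTypeTransport.stubLT_prodUnique_holds` (its statement spells the two CM local families of record).
/-- **`X_v(μ, a₁, χ_f) ≃ X_v(μ, a₂, χ_f)` at `Equiv.prodUnique (Fin 3) (Fin 1)` for EVERY continuous unitary `χ_f` (no automorphy)**, given the
line-transport witness `a₂⁻¹δ = x·x̄·a₁⁻¹δ`: the proof of ★ `stubLT_prodUnique_holds` verbatim with `χ.1 ↦ χf` — the line isometry `M_x` (★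
`lineTransportOp`) intertwines the two local Weil representations along `k ↦ k ⊗ 1` (★ `lineTransportOp_omegaLoc_localLineInl'`, S6a inside), the centres factor
through `k ↦ k ⊗ 1` (★ `localLineInl_localCenter`), and the relation submodule of the `χ_f`-coinvariants does not depend on the line presenting the centre
(★ `LemD1OfPlace.ker_localCenter_eq_of_line`); generic descent ★ `nonempty_equiv_rep_comp_of_intertwiner`; read on ★ `xThetaCM` (an `abbrev`).
Automorphy of `χ_f` enters LT only through the re-enumeration LR, which is not needed at `Equiv.prodUnique`.
[cite: Liu2021, App. D Lem D.1 (3) (l. 5233)] [cite: MoeglinVignerasWaldspurger1987, Chap. 2 II.1 (A)–(B), Chap. 3 I.1–I.3, IV.4] [cite: Kudla1994, §3 Thm 3.1] -/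
theorem nonempty_equiv_xThetaCM_prodUnique_of_lineDelta_witness (L : Type) [Field L] [NumberField L] [IsCMField L] (dV : Fin 3 → L)
    (hdV : ∀ i, IsCMField.complexConj L (dV i) = dV i) (hdV0 : ∀ i, dV i ≠ 0)
    (μ : Literature.NumberTheory.Automorphic.IdeleClassGroup L →ₜ* Circle) (hμ : IsConjugateSymplectic L μ)
    (a₁ a₂ : (↥(maximalRealSubfield L))ˣ) (χf : UnitaryGroup.finAdelicOne (↥(maximalRealSubfield L)) L (IsCMField.complexConj L) →* ℂˣ)
    (v : HeightOneSpectrum (𝓞 ↥(maximalRealSubfield L))) (x : (LocalRing L v)ˣ)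
    (hx : algebraMap L (LocalRing L v) (algebraMap (↥(maximalRealSubfield L)) L (↑a₂⁻¹ : ↥(maximalRealSubfield L)) * imagUnit L) =
        (x : LocalRing L v) * conjLocal L (IsCMField.complexConj L) v x *
          algebraMap L (LocalRing L v) (algebraMap (↥(maximalRealSubfield L)) L (↑a₁⁻¹ : ↥(maximalRealSubfield L)) * imagUnit L)) :
    Nonempty (Representation.Equiv (xThetaCM L (Equiv.prodUnique (Fin 3) (Fin 1)) dV hdV hdV0 μ hμ χf a₁ v)
      (xThetaCM L (Equiv.prodUnique (Fin 3) (Fin 1)) dV hdV hdV0 μ hμ χf a₂ v)) :=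
  F0P2eStubLTLocalTypeTransport.nonempty_equiv_rep_comp_of_intertwiner
    (localCenter L (IsCMField.complexConj L) 3 (Matrix.diagonal dV) (JW (↥(maximalRealSubfield L)) L a₁)
      (JW_apply_ne_zero (↥(maximalRealSubfield L)) L a₁) v)
    (fun h => (localLineInl_localCenter L (IsCMField.complexConj L) 3 (Equiv.prodUnique (Fin 3) (Fin 1)) (Matrix.diagonal dV)
      (JW (↥(maximalRealSubfield L)) L a₁) (JW (↥(maximalRealSubfield L)) L a₁) (JW_apply_ne_zero (↥(maximalRealSubfield L)) L a₁) v h).symm)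
    (fun h => (localLineInl_localCenter L (IsCMField.complexConj L) 3 (Equiv.prodUnique (Fin 3) (Fin 1)) (Matrix.diagonal dV)
      (JW (↥(maximalRealSubfield L)) L a₂) (JW (↥(maximalRealSubfield L)) L a₁) (JW_apply_ne_zero (↥(maximalRealSubfield L)) L a₁) v h).symm)
    (Literature.RepresentationTheory.MoeglinVignerasWaldspurger1987.lineTransportOp L v (IsCMField.complexConj L) 3
      (conj_lineDelta (complexConj_imagUnit L) a₁) (lineDelta_ne_zero (imagUnit_ne_zero L) a₁) (lineDelta_mul_self (imagUnit_mul_self L) a₁)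
      (conj_lineDelta (complexConj_imagUnit L) a₂) (lineDelta_ne_zero (imagUnit_ne_zero L) a₂) (lineDelta_mul_self (imagUnit_mul_self L) a₂) x
      (realDiagonal L dV hdV) (realDiagonal_isSymm L dV hdV) (isUnit_det_realDiagonal L dV hdV hdV0) hx)
    (fun u Φ => lineTransportOp_omegaLoc_localLineInl' L dV hdV hdV0 v (toHeckeCharacter L μ)
      ((isOscillatorChar_toHeckeCharacter_iff μ).mpr hμ) a₁ a₂ x hx u Φ)
    (LemD1OfPlace.ker_localCenter_eq_of_line L v (IsCMField.complexConj L) 3 _ (complexConj_imagUnit L) (imagUnit_ne_zero L) (by norm_num)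
      (reindex_kronecker_JW_hermitian (↥(maximalRealSubfield L)) L (IsCMField.complexConj L) 3 (Equiv.prodUnique (Fin 3) (Fin 1))
        (Matrix.diagonal dV) (realDiagonal_isSymm L dV hdV) (realDiagonal_map L dV hdV).symm a₂)
      (det_reindex_kronecker_JW_ne_zero (↥(maximalRealSubfield L)) L 3 (Equiv.prodUnique (Fin 3) (Fin 1)) (Matrix.diagonal dV)
        (isUnit_det_realDiagonal L dV hdV hdV0) (realDiagonal_map L dV hdV).symm a₂)
      _ χf (JW (↥(maximalRealSubfield L)) L a₁) (JW (↥(maximalRealSubfield L)) L a₂)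
      (JW_apply_ne_zero (↥(maximalRealSubfield L)) L a₁) (JW_apply_ne_zero (↥(maximalRealSubfield L)) L a₂))

set_option synthInstance.maxHeartbeats 400000 in
set_option maxHeartbeats 8000000 in
-- heartbeats: as §3.
/-- **D4 VERBATIM AT `e₁ := Equiv.prodUnique (Fin 3) (Fin 1)`** (no automorphy: the body of tier-0 `StubThetaTypeWittClassInvariant` :394 with the enumeration
binder instantiated at `Equiv.prodUnique (Fin 3) (Fin 1)` and NOTHING else changed): if `ε₂ε₁⁻¹ = x·x̄` then a class which is the theta type
`X_v(μ,ε₁,χ_f) ∘ κ_v⁻¹` is the theta type `X_v(μ,ε₂,χ_f) ∘ κ_v⁻¹` — §1 + §4 + ★ `nonempty_equiv_comp` + ★ `isotypicComponent_eq_top_of_equiv`.  (The general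
enumeration for a non-automorphic `χ_f` needs a LOCAL re-enumeration brick the tree does not have; §3 covers every `e₁` for automorphic `χ_f`.)
[cite: GelbartRogawski1991, §3.1 Prop. 3.1.1 p. 455; Lem. 5.1.2 p. 466] [cite: MoeglinVignerasWaldspurger1987, Chap. 3 §IV.4] [cite: Liu2021, Def. 4.11; App. D Lem. D.1 (3)] -/
theorem thetaTypeWittClassInvariant_prodUnique :
    ∀ (L : Type) [Field L] [NumberField L] [IsCMField L] (H : Matrix (Fin 3) (Fin 3) L)
    (dV : Fin 3 → L) (hdV : ∀ i, IsCMField.complexConj L (dV i) = dV i) (hdV0 : ∀ i, dV i ≠ 0) (g : GL (Fin 3) L)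
    (hg : ((g : Matrix (Fin 3) (Fin 3) L).map (cmConjRingHom L))ᵀ * H * (g : Matrix (Fin 3) (Fin 3) L) = Matrix.diagonal dV)
    (μ : Literature.NumberTheory.Automorphic.IdeleClassGroup L →ₜ* Circle) (hμ : IsConjugateSymplectic L μ)
    (χf : UnitaryGroup.finAdelicOne (↥(maximalRealSubfield L)) L (IsCMField.complexConj L) →* ℂˣ),
    Continuous χf → (∀ z, ‖((χf z : ℂˣ) : ℂ)‖ = 1) →
    ∀ (v : HeightOneSpectrum (𝓞 ↥(maximalRealSubfield L))), (∀ w : PlacesOver L v, IsCMField.complexConj L • w.1 = w.1) →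
    ∀ (ε₁ ε₂ : (↥(maximalRealSubfield L))ˣ),
      (∃ x : (LocalRing L v)ˣ, (x : LocalRing L v) * conjLocal L (IsCMField.complexConj L) v x =
        algebraMap L (LocalRing L v) (((ε₂ * ε₁⁻¹ : (↥(maximalRealSubfield L))ˣ) : ↥(maximalRealSubfield L)) : L)) →
      ∀ (c : IrrClass ((cmDatum L 3 H).Local v)),
        ThetaTypeAtCM L H (Equiv.prodUnique (Fin 3) (Fin 1)) dV hdV hdV0 g hg μ hμ χf ε₁ v c →
          ThetaTypeAtCM L H (Equiv.prodUnique (Fin 3) (Fin 1)) dV hdV hdV0 g hg μ hμ χf ε₂ v c := by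
  intro L _ _ _ H dV hdV hdV0 g hg μ hμ χf _ _ v _ ε₁ ε₂ hN c hθ
  obtain ⟨x, hx⟩ := hN
  obtain ⟨E⟩ := nonempty_equiv_xThetaCM_prodUnique_of_lineDelta_witness L dV hdV hdV0 μ hμ ε₁ ε₂ χf v x⁻¹
    (lineDelta_witness_of_mul_conjLocal_eq L v ε₁ ε₂ x hx)
  obtain ⟨E'⟩ := F0P2iGRDSplitTransport.nonempty_equiv_comp E
    (localCongr L (IsCMField.complexConj L) g one_ne_zero (by rw [one_smul]; exact hg) v).symm.toMulEquiv.toMonoidHom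
  intro T _ _ τ hτ hconst W' _ _ ρ' hρ'
  exact F0P2iThetaTypeCriterion.isotypicComponent_eq_top_of_equiv ρ' E' (hθ T τ hτ hconst W' ρ' hρ')

end Summit.HodgeConjecture.HodgeConjecture.Cruxes.H413.K2E2WThetaTypeWittClassInvariant

end
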